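import Mathlib
import Literature.Computability.AlgebraicComplexity.DeterminantalConormalBound
import Literature.RingTheory.KrullDimension.AffineDimension
import Summits.ValiantsHypothesis.ValiantsHypothesis.Theorems.DetQPDetqpSuperquadraticPolarGenericFibres

/-!
# Crux `DetQP.DetqpSuperquadratic` (stmt-ValiantsHypothesis-0318), line `sectional-class-ladder` —
# stub `stub_polarGenericFinite`: generic finiteness of polar sets

For EVERY polynomial `g ∈ ℂ[x_1, …, x_N]` (no homogeneity needed) there is a non-zero polynomial
`Φ` in the pencil/chart data `u = (a, b, c) ∈ (ℂ^N)^3` such that the polar set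
`T_g(a, b, c) = {x : g(x) = 0, ∇g(x) ≠ 0, ∇g(x) ∈ ℂa + ℂb, c·x = 1}`
(`Literature.Computability.AlgebraicComplexity.polarSet`) is finite whenever `Φ(u) ≠ 0`
(`polarSet_finite_generic`, and the registered stub `stub_polarGenericFinite`).

Proof (dimension count on an affine incidence variety, then generic finiteness of fibres):
for each chart index `i` the polar points with `∂ᵢg(x) ≠ 0` are the `x`-projections of the fibre
over `u` of the incidence variety
`Eᵢ = {(u, x, s, t, w) : g(x) = 0, ∂ⱼg(x) = s aⱼ + t bⱼ (∀ j), Σ cⱼxⱼ = 1, w ∂ᵢg(x) = 1} ⊆ ℂ^{3N} × ℂ^{N+3}`.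
Every irreducible component of `Eᵢ` has dimension `≤ 3N`
(`ringKrullDim_quotient_le_of_polar_relations`): on it, with `s ≠ 0` say, the coordinate ring is
algebraic over the subalgebra generated by the `3N` functions
`x_j (j ≠ j₀), s, t, b_j, c_j (j ≠ j₁)` — `a_j = (∂ⱼg(x) - t bⱼ)/s`, `w = 1/∂ᵢg(x)`,
`c_{j₁} = (1 - Σ_{j ≠ j₁} cⱼxⱼ)/x_{j₁}` for an `x_{j₁} ≠ 0`, and some `x_{j₀}` is algebraic over the
other `xⱼ` because `g(x) = 0`, `g ≠ 0` — so `dim = trdeg ≤ 3N` (`ringKrullDim_le_of_polar_chart`,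
with the algebraicity tools of `…PolarGenericFibres.lean`). Generic finiteness of the fibres of
`Eᵢ → ℂ^{3N}` (`exists_ne_zero_finite_fibre`, same file) gives `Φᵢ`, and `Φ = Πᵢ Φᵢ`.
-/

noncomputable section

-- `Summit.ValiantsHypothesis.ValiantsHypothesis.…` is the tree's mandated single-conjunct layout (Sub = Summit).
set_option linter.dupNamespace false

namespace Summit.ValiantsHypothesis.ValiantsHypothesis.Theorems.DetQPDetqpSuperquadratic

open MvPolynomial
open Literature.Computability.AlgebraicComplexity
open Literature.RingTheory.KrullDimension

/-! ### The dimension count on one chart of the incidence variety -/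

/-- **The chart count.** Let `B` be an affine domain over `ℂ` generated by elements `ξ v`
indexed by `v ∈ (Fin 3 × Fin N) ⊕ (Fin N ⊕ Fin 3)` — written `a_j, b_j, c_j` (`v = inl (0,j),
inl (1,j), inl (2,j)`), `x_j` (`v = inr (inl j)`) and `s, t, w` (`v = inr (inr 0), inr (inr 1),
inr (inr 2)`) — and `dg_j ∈ ℂ[x]` such that, with `{ε, ε'} = {0, 1}` and `σ_ε ∈ {s, t}` the
variable of index `inr (inr ε)`: `σ_ε ≠ 0`, `σ_ε · (ε-th of a_j, b_j) = dg_j - σ_{ε'} · (ε'-th)`,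
`dg_i ≠ 0`, `dg_i w = 1`, `x_{j₁} ≠ 0`, `Σ c_j x_j = 1`, and `x_{j₀}` algebraic over
`ℂ[x_j : j ≠ j₀]`. Then `dim B ≤ 3N`: `B` is algebraic over
`ℂ[(ε'-th family), c_j (j ≠ j₁), x_j (j ≠ j₀), s, t]`. [folklore] -/
theorem ringKrullDim_le_of_polar_chart {B : Type*} [CommRing B] [IsDomain B] [Algebra ℂ B]
    [Algebra.FiniteType ℂ B] {N : ℕ} (ξ : (Fin 3 × Fin N) ⊕ (Fin N ⊕ Fin 3) → B)
    (hgen : Algebra.adjoin ℂ (Set.range ξ) = ⊤) (dg : Fin N → B)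
    (hdg : ∀ j, dg j ∈ Algebra.adjoin ℂ (Set.range fun j => ξ (Sum.inr (Sum.inl j))))
    (ε ε' : Fin 3) (hε : ε = 0 ∧ ε' = 1 ∨ ε = 1 ∧ ε' = 0) (hu0 : ξ (Sum.inr (Sum.inr ε)) ≠ 0)
    (hlin : ∀ j, ξ (Sum.inr (Sum.inr ε)) * ξ (Sum.inl (ε, j)) =
      dg j - ξ (Sum.inr (Sum.inr ε')) * ξ (Sum.inl (ε', j)))
    (i : Fin N) (hdi : dg i ≠ 0) (hw : dg i * ξ (Sum.inr (Sum.inr 2)) = 1)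
    (j₁ : Fin N) (hx1 : ξ (Sum.inr (Sum.inl j₁)) ≠ 0)
    (hc : ∑ j, ξ (Sum.inl (2, j)) * ξ (Sum.inr (Sum.inl j)) = 1) (j₀ : Fin N)
    (hj0 : IsAlgebraic (Algebra.adjoin ℂ ((fun j => ξ (Sum.inr (Sum.inl j))) '' {j₀}ᶜ))
      (ξ (Sum.inr (Sum.inl j₀)))) :
    ringKrullDim B ≤ (3 * N : ℕ) := by
  classical
  have hε2 : ε ≠ 2 := by rcases hε with ⟨rfl, rfl⟩ | ⟨rfl, rfl⟩ <;> decide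
  have hε'2 : ε' ≠ 2 := by rcases hε with ⟨rfl, rfl⟩ | ⟨rfl, rfl⟩ <;> decide
  have hεε' : ε' ≠ ε := by rcases hε with ⟨rfl, rfl⟩ | ⟨rfl, rfl⟩ <;> decide
  -- the kept indices
  set keep : Finset ((Fin 3 × Fin N) ⊕ (Fin N ⊕ Fin 3)) :=
    (Finset.univ.image fun j : Fin N => (Sum.inl (ε', j) : (Fin 3 × Fin N) ⊕ (Fin N ⊕ Fin 3))) ∪
    ((Finset.univ.erase j₁).image fun j : Fin N =>
      (Sum.inl (2, j) : (Fin 3 × Fin N) ⊕ (Fin N ⊕ Fin 3))) ∪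
    ((Finset.univ.erase j₀).image fun j : Fin N =>
      (Sum.inr (Sum.inl j) : (Fin 3 × Fin N) ⊕ (Fin N ⊕ Fin 3))) ∪
    {Sum.inr (Sum.inr 0), Sum.inr (Sum.inr 1)} with hkeep
  have hcard : keep.card ≤ 3 * N := by
    have hN : 1 ≤ N := Nat.one_le_of_lt j₁.pos
    have h1 : (Finset.univ.image fun j : Fin N =>
        (Sum.inl (ε', j) : (Fin 3 × Fin N) ⊕ (Fin N ⊕ Fin 3))).card ≤ N :=
      Finset.card_image_le.trans (by simp)
    have h2 : ((Finset.univ.erase j₁).image fun j : Fin N =>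
        (Sum.inl (2, j) : (Fin 3 × Fin N) ⊕ (Fin N ⊕ Fin 3))).card ≤ N - 1 :=
      Finset.card_image_le.trans (by rw [Finset.card_erase_of_mem (Finset.mem_univ _),
        Finset.card_univ, Fintype.card_fin])
    have h3 : ((Finset.univ.erase j₀).image fun j : Fin N =>
        (Sum.inr (Sum.inl j) : (Fin 3 × Fin N) ⊕ (Fin N ⊕ Fin 3))).card ≤ N - 1 :=
      Finset.card_image_le.trans (by rw [Finset.card_erase_of_mem (Finset.mem_univ _),
        Finset.card_univ, Fintype.card_fin])
    have h4 : ({Sum.inr (Sum.inr 0), Sum.inr (Sum.inr 1)} :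
        Finset ((Fin 3 × Fin N) ⊕ (Fin N ⊕ Fin 3))).card ≤ 2 := Finset.card_le_two
    have := ((Finset.card_union_le _ _).trans (add_le_add ((Finset.card_union_le _ _).trans
      (add_le_add ((Finset.card_union_le _ _).trans (add_le_add h1 h2)) h3)) h4))
    rw [hkeep]
    omega
  -- membership of the kept indices
  have hk_eps' : ∀ j, Sum.inl (ε', j) ∈ keep := fun j => by simp [hkeep]
  have hk_c : ∀ j, j ≠ j₁ → Sum.inl (2, j) ∈ keep := fun j hj => by simp [hkeep, hj]
  have hk_x : ∀ j, j ≠ j₀ → Sum.inr (Sum.inl j) ∈ keep := fun j hj => by simp [hkeep, hj]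
  have hk_0 : Sum.inr (Sum.inr 0) ∈ keep := by simp [hkeep]
  have hk_1 : Sum.inr (Sum.inr 1) ∈ keep := by simp [hkeep]
  have hk_s : Sum.inr (Sum.inr ε) ∈ keep := by
    rcases hε with ⟨rfl, -⟩ | ⟨rfl, -⟩
    exacts [hk_0, hk_1]
  have hk_t : Sum.inr (Sum.inr ε') ∈ keep := by
    rcases hε with ⟨-, rfl⟩ | ⟨-, rfl⟩
    exacts [hk_1, hk_0]
  -- the two subalgebras `C₀ = ℂ[ξ(keep)] ⊆ C₁ = ℂ[ξ(keep), x]`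
  set I₀ : Set B := ξ '' ↑keep with hI₀
  set T : Set B := Set.range fun j => ξ (Sum.inr (Sum.inl j)) with hT
  have hmemI₀ : ∀ v ∈ keep, ξ v ∈ I₀ := fun v hv => ⟨v, Finset.mem_coe.2 hv, rfl⟩
  set C₁ : Subalgebra ℂ B := Algebra.adjoin ℂ (I₀ ∪ T) with hC₁
  have hT_C₁ : ∀ j, ξ (Sum.inr (Sum.inl j)) ∈ C₁ := fun j =>
    Algebra.subset_adjoin (Or.inr ⟨j, rfl⟩)
  have hI₀_C₁ : ∀ v ∈ keep, ξ v ∈ C₁ := fun v hv => Algebra.subset_adjoin (Or.inl (hmemI₀ v hv))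
  have hdg_C₁ : ∀ j, dg j ∈ C₁ := fun j => Algebra.adjoin_mono Set.subset_union_right (hdg j)
  -- every generator is algebraic over `C₁`
  have hgenC₁ : ∀ v, IsAlgebraic C₁ (ξ v) := by
    intro v
    by_cases hv : v ∈ keep
    · exact isAlgebraic_algebraMap (⟨ξ v, hI₀_C₁ v hv⟩ : C₁)
    rcases v with ⟨e, j⟩ | j | e
    · have he : e = ε ∨ e = ε' ∨ e = 2 := by
        rcases hε with ⟨rfl, rfl⟩ | ⟨rfl, rfl⟩ <;> fin_cases e <;> simp
      rcases he with rfl | rfl | rfl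
      · -- `σ_ε · ξ = dg_j - σ_ε' · (other)`
        exact isAlgebraic_of_mul_eq C₁ (hI₀_C₁ _ hk_s) (sub_mem (hdg_C₁ j)
          (mul_mem (hI₀_C₁ _ hk_t) (hI₀_C₁ _ (hk_eps' j)))) hu0 (hlin j)
      · exact absurd (hk_eps' j) hv
      · by_cases hj : j = j₁
        · subst hj
          -- `x_{j₁} c_{j₁} = 1 - Σ_{j ≠ j₁} c_j x_j`
          refine isAlgebraic_of_mul_eq C₁ (hT_C₁ j)
            (r := 1 - ∑ k ∈ Finset.univ.erase j, ξ (Sum.inl (2, k)) * ξ (Sum.inr (Sum.inl k)))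
            (sub_mem (one_mem _) (sum_mem fun k hk => mul_mem
              (hI₀_C₁ _ (hk_c k (Finset.ne_of_mem_erase hk))) (hT_C₁ k))) hx1 ?_
          rw [← hc, ← Finset.insert_erase (Finset.mem_univ j),
            Finset.sum_insert (Finset.notMem_erase j _), Finset.insert_erase (Finset.mem_univ j)]
          ring
        · exact absurd (hk_c j hj) hv
    · exact isAlgebraic_algebraMap (⟨_, hT_C₁ j⟩ : C₁)
    · have he : e = 2 := by
        fin_cases e
        · exact absurd hk_0 hv
        · exact absurd hk_1 hv
        · rfl
      subst he
      exact isAlgebraic_of_mul_eq C₁ (hdg_C₁ i) (one_mem _) hdi hw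
  -- transfer to `C₀`: the extra generators `x_j` of `C₁` are algebraic over `C₀`
  have hT_C₀ : ∀ z ∈ (I₀ ∪ T) \ I₀, IsAlgebraic (Algebra.adjoin ℂ I₀) z := by
    rintro z ⟨hz, hzI⟩
    rcases hz with hz | ⟨j, rfl⟩
    · exact absurd hz hzI
    · by_cases hj : j = j₀
      · subst hj
        refine isAlgebraic_adjoin_mono ?_ hj0
        rintro _ ⟨k, hk, rfl⟩
        exact hmemI₀ _ (hk_x k hk)
      · exact absurd (hmemI₀ _ (hk_x j hj)) hzI
  have hgenC₀ : ∀ v, IsAlgebraic (Algebra.adjoin ℂ I₀) (ξ v) := fun v =>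
    (hgenC₁ v).adjoin_of_forall_isAlgebraic hT_C₀
  haveI := isAlgebraic_adjoin_of_forall_generator ξ hgen I₀ hgenC₀
  exact (ringKrullDim_le_card_of_isAlgebraic_adjoin (K := ℂ) ξ keep).trans (by exact_mod_cast hcard)

/-- **Components of the incidence variety have dimension `≤ 3N`.** For a prime `Q` of
`ℂ[(a, b, c), (x, s, t, w)]` containing the polar relations of chart `i` —
`g(x)`, `∂ⱼg(x) - s aⱼ - t bⱼ`, `Σ cⱼ xⱼ - 1`, `∂ᵢg(x) w - 1` — the affine domain `ℂ[…] ⧸ Q` has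
Krull dimension at most `3N`. [folklore] -/
theorem ringKrullDim_quotient_le_of_polar_relations {N : ℕ} (g : MvPolynomial (Fin N) ℂ)
    (i : Fin N) (Q : Ideal (MvPolynomial ((Fin 3 × Fin N) ⊕ (Fin N ⊕ Fin 3)) ℂ)) [Q.IsPrime]
    (h1 : rename (Sum.inr ∘ Sum.inl) g ∈ Q)
    (h2 : ∀ j, rename (Sum.inr ∘ Sum.inl) (pderiv j g) -
      X (Sum.inr (Sum.inr 0)) * X (Sum.inl (0, j)) - X (Sum.inr (Sum.inr 1)) * X (Sum.inl (1, j)) ∈ Q)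
    (h3 : ∑ j, X (Sum.inl (2, j)) * X (Sum.inr (Sum.inl j)) - 1 ∈ Q)
    (h4 : rename (Sum.inr ∘ Sum.inl) (pderiv i g) * X (Sum.inr (Sum.inr 2)) - 1 ∈ Q) :
    ringKrullDim (MvPolynomial ((Fin 3 × Fin N) ⊕ (Fin N ⊕ Fin 3)) ℂ ⧸ Q) ≤ (3 * N : ℕ) := by
  classical
  haveI : IsDomain (MvPolynomial ((Fin 3 × Fin N) ⊕ (Fin N ⊕ Fin 3)) ℂ ⧸ Q) :=
    Ideal.Quotient.isDomain Q
  set π : MvPolynomial ((Fin 3 × Fin N) ⊕ (Fin N ⊕ Fin 3)) ℂ →ₐ[ℂ]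
    MvPolynomial ((Fin 3 × Fin N) ⊕ (Fin N ⊕ Fin 3)) ℂ ⧸ Q := Ideal.Quotient.mkₐ ℂ Q with hπdef
  have hπsurj : Function.Surjective π := Ideal.Quotient.mkₐ_surjective ℂ Q
  haveI : Algebra.FiniteType ℂ (MvPolynomial ((Fin 3 × Fin N) ⊕ (Fin N ⊕ Fin 3)) ℂ ⧸ Q) :=
    Algebra.FiniteType.of_surjective π hπsurj
  have hQ0 : ∀ p ∈ Q, π p = 0 := fun p hp => Ideal.Quotient.eq_zero_iff_mem.2 hp
  obtain ⟨ξ, hξ⟩ : ∃ ξ : (Fin 3 × Fin N) ⊕ (Fin N ⊕ Fin 3) →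
      MvPolynomial ((Fin 3 × Fin N) ⊕ (Fin N ⊕ Fin 3)) ℂ ⧸ Q, ∀ v, π (X v) = ξ v :=
    ⟨_, fun _ => rfl⟩
  have hπren : ∀ p : MvPolynomial (Fin N) ℂ,
      π (rename (Sum.inr ∘ Sum.inl) p) = aeval (fun j => ξ (Sum.inr (Sum.inl j))) p := by
    intro p
    have := MvPolynomial.algHom_ext (f := π.comp (rename (Sum.inr ∘ Sum.inl)))
      (g := aeval fun j => ξ (Sum.inr (Sum.inl j))) (fun j => by simp [hξ])
    exact AlgHom.congr_fun this p
  have hgen : Algebra.adjoin ℂ (Set.range ξ) = ⊤ := by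
    have hr : Set.range ξ = π '' Set.range X := by
      rw [← Set.range_comp]
      exact congrArg Set.range (funext fun v => (hξ v).symm)
    rw [hr, ← AlgHom.map_adjoin, MvPolynomial.adjoin_range_X, Algebra.map_top,
      AlgHom.range_eq_top]
    exact hπsurj
  set dg : Fin N → MvPolynomial ((Fin 3 × Fin N) ⊕ (Fin N ⊕ Fin 3)) ℂ ⧸ Q :=
    fun j => aeval (fun j => ξ (Sum.inr (Sum.inl j))) (pderiv j g) with hdgdef
  have hdg : ∀ j, dg j ∈ Algebra.adjoin ℂ (Set.range fun j => ξ (Sum.inr (Sum.inl j))) := by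
    intro j
    rw [Algebra.adjoin_range_eq_range_aeval]
    exact ⟨_, rfl⟩
  -- the relations
  have F1 : aeval (fun j => ξ (Sum.inr (Sum.inl j))) g = 0 := by
    rw [← hπren]
    exact hQ0 _ h1
  have F2 : ∀ j, dg j = ξ (Sum.inr (Sum.inr 0)) * ξ (Sum.inl (0, j)) +
      ξ (Sum.inr (Sum.inr 1)) * ξ (Sum.inl (1, j)) := by
    intro j
    have := hQ0 _ (h2 j)
    simp only [map_sub, map_mul, hπren, hξ] at this
    linear_combination this
  have F3 : ∑ j, ξ (Sum.inl (2, j)) * ξ (Sum.inr (Sum.inl j)) = 1 := by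
    have := hQ0 _ h3
    simp only [map_sub, map_sum, map_mul, map_one, hξ] at this
    linear_combination this
  have F4 : dg i * ξ (Sum.inr (Sum.inr 2)) = 1 := by
    have := hQ0 _ h4
    simp only [map_sub, map_mul, map_one, hπren, hξ] at this
    linear_combination this
  -- consequences
  have hdi : dg i ≠ 0 := fun h => by
    rw [h, zero_mul] at F4
    exact zero_ne_one F4
  obtain ⟨j₁, hx1⟩ : ∃ j₁, ξ (Sum.inr (Sum.inl j₁)) ≠ 0 := by
    by_contra h
    push Not at h
    simp [h] at F3
  have hg0 : g ≠ 0 := fun h => hdi (by simp [hdgdef, h])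
  have hdep : ¬ AlgebraicIndependent ℂ (fun j => ξ (Sum.inr (Sum.inl j))) := fun h =>
    hg0 (h (F1.trans (map_zero _).symm))
  obtain ⟨j₀, hj0⟩ := exists_isAlgebraic_adjoin_image_compl _ hdep
  by_cases hs : ξ (Sum.inr (Sum.inr 0)) = 0
  · have ht : ξ (Sum.inr (Sum.inr 1)) ≠ 0 := fun ht => hdi (by rw [F2 i, hs, ht]; ring)
    exact ringKrullDim_le_of_polar_chart ξ hgen dg hdg 1 0 (Or.inr ⟨rfl, rfl⟩) ht
      (fun j => by rw [F2 j]; ring) i hdi F4 j₁ hx1 F3 j₀ hj0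
  · exact ringKrullDim_le_of_polar_chart ξ hgen dg hdg 0 1 (Or.inl ⟨rfl, rfl⟩) hs
      (fun j => by rw [F2 j]; ring) i hdi F4 j₁ hx1 F3 j₀ hj0

/-! ### Generic finiteness of polar sets -/

/-- **Generic finiteness of polar sets.** For every `g ∈ ℂ[x_1, …, x_N]` there is a non-zero
polynomial `Φ` in the data `u = (a, b, c)` such that the polar set `T_g(a, b, c)` is finite
whenever `Φ(u) ≠ 0`. [folklore] -/
theorem polarSet_finite_generic {N : ℕ} (g : MvPolynomial (Fin N) ℂ) :
    ∃ Φ : MvPolynomial (Fin 3 × Fin N) ℂ, Φ ≠ 0 ∧ ∀ u : Fin 3 × Fin N → ℂ, eval u Φ ≠ 0 →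
      (polarSet g (fun i => u (0, i)) (fun i => u (1, i)) (fun i => u (2, i))).Finite := by
  classical
  -- the incidence ideals, one per chart `∂ᵢ g ≠ 0`
  obtain ⟨gen, hgen⟩ : ∃ gen : Fin N → Set (MvPolynomial ((Fin 3 × Fin N) ⊕ (Fin N ⊕ Fin 3)) ℂ),
      ∀ i, gen i = (({rename (Sum.inr ∘ Sum.inl) g} ∪
        Set.range fun j => rename (Sum.inr ∘ Sum.inl) (pderiv j g) -
          X (Sum.inr (Sum.inr 0)) * X (Sum.inl (0, j)) - X (Sum.inr (Sum.inr 1)) * X (Sum.inl (1, j)))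
        ∪ {∑ j, X (Sum.inl (2, j)) * X (Sum.inr (Sum.inl j)) - 1})
        ∪ {rename (Sum.inr ∘ Sum.inl) (pderiv i g) * X (Sum.inr (Sum.inr 2)) - 1} :=
    ⟨_, fun _ => rfl⟩
  have hdim : ∀ i, ringKrullDim (MvPolynomial ((Fin 3 × Fin N) ⊕ (Fin N ⊕ Fin 3)) ℂ ⧸
      Ideal.span (gen i)) ≤ Nat.card (Fin 3 × Fin N) := by
    intro i
    have hcardP : Nat.card (Fin 3 × Fin N) = 3 * N := by simp
    rw [hcardP]
    refine ringKrullDim_quotient_le_of_forall_isPrime _ _ fun Q hQ hle => ?_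
    haveI := hQ
    have hsub : gen i ⊆ Q := Ideal.span_le.1 hle
    refine ringKrullDim_quotient_le_of_polar_relations g i Q (hsub ?_) (fun j => hsub ?_)
      (hsub ?_) (hsub ?_)
    · rw [hgen]; exact Or.inl (Or.inl (Or.inl rfl))
    · rw [hgen]; exact Or.inl (Or.inl (Or.inr ⟨j, rfl⟩))
    · rw [hgen]; exact Or.inl (Or.inr rfl)
    · rw [hgen]; exact Or.inr rfl
  choose Φ hΦ0 hΦ using fun i => exists_ne_zero_finite_fibre (Ideal.span (gen i)) (hdim i)
  refine ⟨∏ i, Φ i, Finset.prod_ne_zero_iff.2 fun i _ => hΦ0 i, fun u hu => ?_⟩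
  rw [map_prod, Finset.prod_ne_zero_iff] at hu
  -- the polar set lies in the union of the `x`-projections of the fibres over `u`
  have hcov : polarSet g (fun i => u (0, i)) (fun i => u (1, i)) (fun i => u (2, i)) ⊆
      ⋃ i, (fun y : Fin N ⊕ Fin 3 → ℂ => fun j => y (Sum.inl j)) ''
        {y | Sum.elim u y ∈ zeroLocus ℂ (Ideal.span (gen i))} := by
    intro x hx
    rw [mem_polarSet] at hx
    obtain ⟨hg, ⟨i, hi⟩, ⟨s, t, hst⟩, hc⟩ := hx
    refine Set.mem_iUnion.2 ⟨i, Sum.elim x ![s, t, (eval x (pderiv i g))⁻¹], ?_, rfl⟩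
    show Sum.elim u (Sum.elim x ![s, t, (eval x (pderiv i g))⁻¹]) ∈ zeroLocus ℂ (Ideal.span (gen i))
    have hev : ∀ q : MvPolynomial (Fin N) ℂ,
        aeval (Sum.elim u (Sum.elim x ![s, t, (eval x (pderiv i g))⁻¹]))
          (rename (Sum.inr ∘ Sum.inl) q) = eval x q := by
      intro q
      rw [aeval_rename]
      rfl
    rw [zeroLocus_span, hgen]
    rintro p (((rfl | ⟨j, rfl⟩) | rfl) | rfl)
    · rw [hev]; exact hg
    · simp only [map_sub, map_mul, hev, aeval_X, Sum.elim_inr, Sum.elim_inl]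
      simp only [Matrix.cons_val_zero, Matrix.cons_val_one]
      linear_combination hst j
    · simp only [map_sub, map_sum, map_mul, map_one, aeval_X, Sum.elim_inl, Sum.elim_inr]
      rw [hc, sub_self]
    · simp only [map_sub, map_mul, map_one, hev, aeval_X, Sum.elim_inr]
      rw [show ( ![s, t, (eval x (pderiv i g))⁻¹] : Fin 3 → ℂ) 2 = (eval x (pderiv i g))⁻¹ from rfl,
        mul_inv_cancel₀ hi, sub_self]
  exact Set.Finite.subset (Set.finite_iUnion fun i =>
    (hΦ i u (hu i (Finset.mem_univ i))).image _) hcov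

/-- **Registered stub `stub_polarGenericFinite` — generic finiteness of the polar sets of a
form.** For a form `g` of degree `d` in `N` variables there is a non-zero polynomial `Φ` in the
pencil/chart data `u = (a, b, c) ∈ (ℂ^N)^3` off whose zero set the polar set `T_g(a, b, c)` is
finite (`polarSet_finite_generic`; homogeneity is not needed). [folklore] -/
theorem stub_polarGenericFinite {N d : ℕ} (g : MvPolynomial (Fin N) ℂ) (hg : g.IsHomogeneous d) :
    ∃ Φ : MvPolynomial (Fin 3 × Fin N) ℂ, Φ ≠ 0 ∧ ∀ u : Fin 3 × Fin N → ℂ, eval u Φ ≠ 0 →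
      (polarSet g (fun i => u (0, i)) (fun i => u (1, i)) (fun i => u (2, i))).Finite := by
  exact (fun _ => polarSet_finite_generic g) hg

end Summit.ValiantsHypothesis.ValiantsHypothesis.Theorems.DetQPDetqpSuperquadratic
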